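import Summits.CriticalPhenomena.PercolationContinuityZ3.Theorems.PercNearOneGluingNoHeavyLowerTailSahiE3ExchangeCross
import Mathlib.Tactic.Linarith
import Mathlib.Tactic.Ring
import Mathlib.Tactic.Positivity
import HarnessLib
import HarnessLib.Audit

/-!
# `NoHeavyLowerTail` (crux stmt-CriticalPhenomena-4575), Sahi programme P4: the 2×2 exchange lemma in the PURE class — the CUT CHAIN and the low-crossing case

Support file (cell `prim-l12`, seat P4, generation 27; `--supports stmt-CriticalPhenomena-4575`).  No named facts, no sorries;
standard axioms; def-free.

Context (HOME prim-l12-p4/FROM-prim-l12-p4-gen27-*.md; predecessors `…SahiE3ExchangeCross` (crossing-free case),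
`…SahiE3ExchangePure` (Lemma A and the sign cases), `…SahiE3ExchangeChain`).  Harris block `(B, w, V)`, `w ≥ 0` of mass `1`,
`v = w(V)`, `a(X) = w(X∩V)`, `need(X,Y) = x·a(Y) + y·a(X) − v·x·y`; PURE configuration `P = K ⊇ L = O`, `P' = L' ⊇ K' = O'`;
supplies `S₁ = K∩K'∩V`, `S₂ = L∩L'∩V`, `Σ = S₁ ∪ S₂`, `Δ = S₁ ∩ S₂ = L∩K'∩V`; crossing cell `Ξ = V∩(K∖L)∩(L'∖K')`, so that
`K∩L'∩V = Σ ⊔ Ξ`.  Since `↓Ξ` is disjoint from the up-sets `L` and `K'`, for every `Z ⊆ K` with `Ξ ⊆ Z ⊆ ↓Ξ` the set `K∖Z` is an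
up-set and the pair `(K∖Z, L')` has slot-footprint EXACTLY `Σ`; together with the meet pair `(L,K')` (footprint `Δ`) it forms an
admissible 2-packing of the supply `R(S₁) + R(S₂) = R(Σ) + R(Δ)` — the CUT CHAIN (generation 20's `↓Ξ`-cut; this file takes the two
pair inequalities as hypotheses `hSig`, `hDel`, so no order structure on `B` is needed).  Its value is
  `EXCH ≥ T + [a(K∩L') − a(Σ)] − z·a(L') − l'·a(Z) + v·z·l'`,  `T = Har(K;K'_V) + Har(L';L_V) + (1−v)[Har(K,L') + (k−l)(l'−k')] ≥ 0`
(`exchange_pure_of_cutK`), which is `≥ 0` as soon as `z·a(L') + l'·a(Z) − v·z·l' ≤ a(K∩L') − a(Σ)` (`= w(Ξ)`); in particular in the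
LOW-CROSSING case `Z = Ξ` (i.e. `K ∩ ↓Ξ = Ξ`: no point of `K` lies strictly below the crossing cell), where the left side is
`ξ·(a(L') + (1−v)l') ≤ ξ` (`exchange_pure_of_lowCrossK`).  Mirror statements cut on the `L'` side (`…cutL'`, `…lowCrossL'`).
The crossing-free theorem of generation 20 is the case `Ξ = ∅`.  Generation 27 (HOME memo): the four packings same / dom-chain /
cut-K / cut-L' ("conjecture P⁺") have no numerical counterexample, while every menu of three of them fails.
-/

namespace Summit.CriticalPhenomena.PercolationContinuityZ3.Theorems.SahiE3ExchangePureCut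

open Finset SahiE3DimerPacking SahiE3ExchangeCross
open scoped BigOperators

variable {B : Type*} [DecidableEq B]

/-- Chain/meet bookkeeping in the pure class: for `L ⊆ K`, `K' ⊆ L'` and any `f`,
`f((KK' ∪ LL')∩V) + f(LK'∩V) = f(KK'V) + f(LL'V)`. [folklore] -/
private theorem sum_sigma_add_sum_delta' (f : B → ℝ) (V K L K' L' : Finset B) (hLK : L ⊆ K) (hK'L' : K' ⊆ L') :
    ∑ b ∈ (K ∩ K' ∪ L ∩ L') ∩ V, f b + ∑ b ∈ (L ∩ K') ∩ V, f b
      = ∑ b ∈ (K ∩ K') ∩ V, f b + ∑ b ∈ (L ∩ L') ∩ V, f b := by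
  simp only [sum_inter_eq_sum_ite, ← Finset.sum_add_distrib]
  refine Finset.sum_congr rfl fun b _ => ?_
  simp only [Finset.mem_inter, Finset.mem_union]
  by_cases hk : b ∈ K <;> by_cases hl : b ∈ L <;> by_cases hk' : b ∈ K' <;> by_cases hl' : b ∈ L' <;>
    simp [hk, hl, hk', hl'] <;> first | exact absurd (hLK hl) hk | exact absurd (hK'L' hk') hl'

/-- For `Z ⊆ X`: `w(X∖Z) = w(X) − w(Z)` and `w((X∖Z)∩V) = w(X∩V) − w(Z∩V)`. [folklore] -/
private theorem sum_sdiff_pair (w : B → ℝ) (V X Z : Finset B) (hZ : Z ⊆ X) :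
    ∑ b ∈ X \ Z, w b = ∑ b ∈ X, w b - ∑ b ∈ Z, w b ∧
      ∑ b ∈ (X \ Z) ∩ V, w b = ∑ b ∈ X ∩ V, w b - ∑ b ∈ Z ∩ V, w b := by
  refine ⟨Finset.sum_sdiff_eq_sub hZ, ?_⟩
  have hset : (X \ Z) ∩ V = (X ∩ V) \ (Z ∩ V) := by
    ext b; simp only [Finset.mem_inter, Finset.mem_sdiff]; tauto
  rw [hset]
  exact Finset.sum_sdiff_eq_sub (Finset.inter_subset_inter hZ le_rfl)

/-- **Cut chain on the `K` side (pure class).**  `w ≥ 0` of mass `1`, `L ⊆ K`, `K' ⊆ L'`, `Z ⊆ K`; a weight `R` satisfying the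
pair inequality of `(K∖Z, L')` on the footprint `Σ = (KK' ∪ LL')∩V` (`hSig`) and of `(L,K')` on `Δ = LK'∩V` (`hDel`); the Harris
products `Har(K;K'_V), Har(L';L_V), Har(K,L') ≥ 0`; and the cut condition `z·a(L') + l'·a(Z) − v·z·l' ≤ a(K∩L') − a(Σ)`
(`hcut`).  Then the pure-class exchange expression is `≥ 0`. [this work] -/
theorem exchange_pure_of_cutK [Fintype B] (w R : B → ℝ) (hw : ∀ b, 0 ≤ w b) (hw1 : ∑ b, w b = 1)
    (V K L K' L' Z : Finset B) (hLK : L ⊆ K) (hK'L' : K' ⊆ L') (hZK : Z ⊆ K)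
    (hSig : (∑ b ∈ K \ Z, w b) * (∑ b ∈ L' ∩ V, w b) + (∑ b ∈ L', w b) * (∑ b ∈ (K \ Z) ∩ V, w b)
        - (∑ b ∈ V, w b) * (∑ b ∈ K \ Z, w b) * (∑ b ∈ L', w b) ≤ ∑ b ∈ (K ∩ K' ∪ L ∩ L') ∩ V, R b)
    (hDel : (∑ b ∈ L, w b) * (∑ b ∈ K' ∩ V, w b) + (∑ b ∈ K', w b) * (∑ b ∈ L ∩ V, w b)
        - (∑ b ∈ V, w b) * (∑ b ∈ L, w b) * (∑ b ∈ K', w b) ≤ ∑ b ∈ (L ∩ K') ∩ V, R b)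
    (hHarKK' : (∑ b ∈ K, w b) * (∑ b ∈ K' ∩ V, w b) ≤ ∑ b ∈ (K ∩ K') ∩ V, w b)
    (hHarL'L : (∑ b ∈ L', w b) * (∑ b ∈ L ∩ V, w b) ≤ ∑ b ∈ (L ∩ L') ∩ V, w b)
    (hHar₄ : (∑ b ∈ K, w b) * (∑ b ∈ L', w b) ≤ ∑ b ∈ K ∩ L', w b)
    (hcut : (∑ b ∈ Z, w b) * (∑ b ∈ L' ∩ V, w b) + (∑ b ∈ L', w b) * (∑ b ∈ Z ∩ V, w b)
        - (∑ b ∈ V, w b) * (∑ b ∈ Z, w b) * (∑ b ∈ L', w b)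
        ≤ (∑ b ∈ (K ∩ L') ∩ V, w b) - ∑ b ∈ (K ∩ K' ∪ L ∩ L') ∩ V, w b) :
    0 ≤ (∑ b ∈ (K ∩ L') ∩ V, w b) + (∑ b ∈ (L ∩ K') ∩ V, w b)
        - (∑ b ∈ K, w b) * (∑ b ∈ K' ∩ V, w b) - (∑ b ∈ L', w b) * (∑ b ∈ L ∩ V, w b)
        + (∑ b ∈ (K ∩ K') ∩ V, R b) + (∑ b ∈ (L ∩ L') ∩ V, R b)
        - ((∑ b ∈ K, w b) * (∑ b ∈ L' ∩ V, w b) + (∑ b ∈ L', w b) * (∑ b ∈ K ∩ V, w b)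
            - (∑ b ∈ V, w b) * (∑ b ∈ K, w b) * (∑ b ∈ L', w b))
        - ((∑ b ∈ L, w b) * (∑ b ∈ K' ∩ V, w b) + (∑ b ∈ K', w b) * (∑ b ∈ L ∩ V, w b)
            - (∑ b ∈ V, w b) * (∑ b ∈ L, w b) * (∑ b ∈ K', w b))
        + (1 - ∑ b ∈ V, w b) * (((∑ b ∈ K ∩ L', w b) - (∑ b ∈ K, w b) * (∑ b ∈ L', w b))
            + ((∑ b ∈ K, w b) - ∑ b ∈ L, w b) * ((∑ b ∈ L', w b) - ∑ b ∈ K', w b)) := by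
  obtain ⟨hz, hzV⟩ := sum_sdiff_pair w V K Z hZK
  have hRid := sum_sigma_add_sum_delta' R V K L K' L' hLK hK'L'
  have hwid := sum_sigma_add_sum_delta' w V K L K' L' hLK hK'L'
  have hv1 : ∑ b ∈ V, w b ≤ 1 := by
    rw [← hw1]; exact sum_le_sum_of_subset' w hw (Finset.subset_univ V)
  have hlk : ∑ b ∈ L, w b ≤ ∑ b ∈ K, w b := sum_le_sum_of_subset' w hw hLK
  have hk'l' : ∑ b ∈ K', w b ≤ ∑ b ∈ L', w b := sum_le_sum_of_subset' w hw hK'L'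
  have e1 : 0 ≤ (1 - ∑ b ∈ V, w b) * ((∑ b ∈ K ∩ L', w b) - (∑ b ∈ K, w b) * (∑ b ∈ L', w b)) :=
    mul_nonneg (by linarith) (by linarith)
  have e2 : 0 ≤ (1 - ∑ b ∈ V, w b) * (((∑ b ∈ K, w b) - ∑ b ∈ L, w b) * ((∑ b ∈ L', w b) - ∑ b ∈ K', w b)) :=
    mul_nonneg (by linarith) (mul_nonneg (by linarith) (by linarith))
  rw [hz, hzV] at hSig
  nlinarith [hSig, hDel, hRid, hwid, hHarKK', hHarL'L, e1, e2, hcut]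

/-- **Low crossing on the `K` side (pure class).**  If the crossing cell `Z = Ξ ⊆ V` carries exactly the slot mass
`a(K∩L') − a(Σ)` (always true for `Ξ = V∩(K∖L)∩(L'∖K')`) and `K∖Ξ` supports the pair inequality on `Σ` — which is the case when
no point of `K` lies strictly below `Ξ` — then the exchange lemma holds: the cut condition reads `ξ·(a(L') + (1−v)·l') ≤ ξ`.
[this work] -/
theorem exchange_pure_of_lowCrossK [Fintype B] (w R : B → ℝ) (hw : ∀ b, 0 ≤ w b) (hw1 : ∑ b, w b = 1)
    (V K L K' L' Z : Finset B) (hLK : L ⊆ K) (hK'L' : K' ⊆ L') (hZK : Z ⊆ K) (hZV : Z ⊆ V)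
    (hZ : ∑ b ∈ Z, w b = (∑ b ∈ (K ∩ L') ∩ V, w b) - ∑ b ∈ (K ∩ K' ∪ L ∩ L') ∩ V, w b)
    (hSig : (∑ b ∈ K \ Z, w b) * (∑ b ∈ L' ∩ V, w b) + (∑ b ∈ L', w b) * (∑ b ∈ (K \ Z) ∩ V, w b)
        - (∑ b ∈ V, w b) * (∑ b ∈ K \ Z, w b) * (∑ b ∈ L', w b) ≤ ∑ b ∈ (K ∩ K' ∪ L ∩ L') ∩ V, R b)
    (hDel : (∑ b ∈ L, w b) * (∑ b ∈ K' ∩ V, w b) + (∑ b ∈ K', w b) * (∑ b ∈ L ∩ V, w b)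
        - (∑ b ∈ V, w b) * (∑ b ∈ L, w b) * (∑ b ∈ K', w b) ≤ ∑ b ∈ (L ∩ K') ∩ V, R b)
    (hHarKK' : (∑ b ∈ K, w b) * (∑ b ∈ K' ∩ V, w b) ≤ ∑ b ∈ (K ∩ K') ∩ V, w b)
    (hHarL'L : (∑ b ∈ L', w b) * (∑ b ∈ L ∩ V, w b) ≤ ∑ b ∈ (L ∩ L') ∩ V, w b)
    (hHar₄ : (∑ b ∈ K, w b) * (∑ b ∈ L', w b) ≤ ∑ b ∈ K ∩ L', w b) :
    0 ≤ (∑ b ∈ (K ∩ L') ∩ V, w b) + (∑ b ∈ (L ∩ K') ∩ V, w b)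
        - (∑ b ∈ K, w b) * (∑ b ∈ K' ∩ V, w b) - (∑ b ∈ L', w b) * (∑ b ∈ L ∩ V, w b)
        + (∑ b ∈ (K ∩ K') ∩ V, R b) + (∑ b ∈ (L ∩ L') ∩ V, R b)
        - ((∑ b ∈ K, w b) * (∑ b ∈ L' ∩ V, w b) + (∑ b ∈ L', w b) * (∑ b ∈ K ∩ V, w b)
            - (∑ b ∈ V, w b) * (∑ b ∈ K, w b) * (∑ b ∈ L', w b))
        - ((∑ b ∈ L, w b) * (∑ b ∈ K' ∩ V, w b) + (∑ b ∈ K', w b) * (∑ b ∈ L ∩ V, w b)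
            - (∑ b ∈ V, w b) * (∑ b ∈ L, w b) * (∑ b ∈ K', w b))
        + (1 - ∑ b ∈ V, w b) * (((∑ b ∈ K ∩ L', w b) - (∑ b ∈ K, w b) * (∑ b ∈ L', w b))
            + ((∑ b ∈ K, w b) - ∑ b ∈ L, w b) * ((∑ b ∈ L', w b) - ∑ b ∈ K', w b)) := by
  have hZV' : Z ∩ V = Z := Finset.inter_eq_left.2 hZV
  have hv1 : ∑ b ∈ V, w b ≤ 1 := by
    rw [← hw1]; exact sum_le_sum_of_subset' w hw (Finset.subset_univ V)
  have haL' : ∑ b ∈ L' ∩ V, w b ≤ ∑ b ∈ V, w b := sum_le_sum_of_subset' w hw Finset.inter_subset_right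
  have hl'1 : ∑ b ∈ L', w b ≤ 1 := by
    rw [← hw1]; exact sum_le_sum_of_subset' w hw (Finset.subset_univ L')
  have hz0 : 0 ≤ ∑ b ∈ Z, w b := Finset.sum_nonneg fun b _ => hw b
  have hl'0 : 0 ≤ ∑ b ∈ L', w b := Finset.sum_nonneg fun b _ => hw b
  refine exchange_pure_of_cutK w R hw hw1 V K L K' L' Z hLK hK'L' hZK hSig hDel hHarKK' hHarL'L hHar₄ ?_
  rw [hZV', ← hZ]
  -- ξ·a(L') + l'·ξ − v·ξ·l' ≤ ξ  ⟸  a(L') ≤ v, l' ≤ 1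
  have e1 : 0 ≤ (∑ b ∈ Z, w b) * ((∑ b ∈ V, w b) - ∑ b ∈ L' ∩ V, w b) := mul_nonneg hz0 (by linarith)
  have e2 : 0 ≤ (∑ b ∈ Z, w b) * ((1 - ∑ b ∈ V, w b) * (1 - ∑ b ∈ L', w b)) :=
    mul_nonneg hz0 (mul_nonneg (by linarith) (by linarith))
  nlinarith [e1, e2]

/-- **Cut chain on the `L'` side (pure class).**  Mirror of `exchange_pure_of_cutK`: `Z ⊆ L'`, the pair `(K, L'∖Z)` on `Σ`,
`(L,K')` on `Δ`, the three Harris products, and the cut condition `k·a(Z) + z·a(K) − v·k·z ≤ a(K∩L') − a(Σ)`. [this work] -/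
theorem exchange_pure_of_cutL' [Fintype B] (w R : B → ℝ) (hw : ∀ b, 0 ≤ w b) (hw1 : ∑ b, w b = 1)
    (V K L K' L' Z : Finset B) (hLK : L ⊆ K) (hK'L' : K' ⊆ L') (hZL' : Z ⊆ L')
    (hSig : (∑ b ∈ K, w b) * (∑ b ∈ (L' \ Z) ∩ V, w b) + (∑ b ∈ L' \ Z, w b) * (∑ b ∈ K ∩ V, w b)
        - (∑ b ∈ V, w b) * (∑ b ∈ K, w b) * (∑ b ∈ L' \ Z, w b) ≤ ∑ b ∈ (K ∩ K' ∪ L ∩ L') ∩ V, R b)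
    (hDel : (∑ b ∈ L, w b) * (∑ b ∈ K' ∩ V, w b) + (∑ b ∈ K', w b) * (∑ b ∈ L ∩ V, w b)
        - (∑ b ∈ V, w b) * (∑ b ∈ L, w b) * (∑ b ∈ K', w b) ≤ ∑ b ∈ (L ∩ K') ∩ V, R b)
    (hHarKK' : (∑ b ∈ K, w b) * (∑ b ∈ K' ∩ V, w b) ≤ ∑ b ∈ (K ∩ K') ∩ V, w b)
    (hHarL'L : (∑ b ∈ L', w b) * (∑ b ∈ L ∩ V, w b) ≤ ∑ b ∈ (L ∩ L') ∩ V, w b)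
    (hHar₄ : (∑ b ∈ K, w b) * (∑ b ∈ L', w b) ≤ ∑ b ∈ K ∩ L', w b)
    (hcut : (∑ b ∈ K, w b) * (∑ b ∈ Z ∩ V, w b) + (∑ b ∈ Z, w b) * (∑ b ∈ K ∩ V, w b)
        - (∑ b ∈ V, w b) * (∑ b ∈ K, w b) * (∑ b ∈ Z, w b)
        ≤ (∑ b ∈ (K ∩ L') ∩ V, w b) - ∑ b ∈ (K ∩ K' ∪ L ∩ L') ∩ V, w b) :
    0 ≤ (∑ b ∈ (K ∩ L') ∩ V, w b) + (∑ b ∈ (L ∩ K') ∩ V, w b)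
        - (∑ b ∈ K, w b) * (∑ b ∈ K' ∩ V, w b) - (∑ b ∈ L', w b) * (∑ b ∈ L ∩ V, w b)
        + (∑ b ∈ (K ∩ K') ∩ V, R b) + (∑ b ∈ (L ∩ L') ∩ V, R b)
        - ((∑ b ∈ K, w b) * (∑ b ∈ L' ∩ V, w b) + (∑ b ∈ L', w b) * (∑ b ∈ K ∩ V, w b)
            - (∑ b ∈ V, w b) * (∑ b ∈ K, w b) * (∑ b ∈ L', w b))
        - ((∑ b ∈ L, w b) * (∑ b ∈ K' ∩ V, w b) + (∑ b ∈ K', w b) * (∑ b ∈ L ∩ V, w b)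
            - (∑ b ∈ V, w b) * (∑ b ∈ L, w b) * (∑ b ∈ K', w b))
        + (1 - ∑ b ∈ V, w b) * (((∑ b ∈ K ∩ L', w b) - (∑ b ∈ K, w b) * (∑ b ∈ L', w b))
            + ((∑ b ∈ K, w b) - ∑ b ∈ L, w b) * ((∑ b ∈ L', w b) - ∑ b ∈ K', w b)) := by
  obtain ⟨hz, hzV⟩ := sum_sdiff_pair w V L' Z hZL'
  have hRid := sum_sigma_add_sum_delta' R V K L K' L' hLK hK'L'
  have hwid := sum_sigma_add_sum_delta' w V K L K' L' hLK hK'L'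
  have hv1 : ∑ b ∈ V, w b ≤ 1 := by
    rw [← hw1]; exact sum_le_sum_of_subset' w hw (Finset.subset_univ V)
  have hlk : ∑ b ∈ L, w b ≤ ∑ b ∈ K, w b := sum_le_sum_of_subset' w hw hLK
  have hk'l' : ∑ b ∈ K', w b ≤ ∑ b ∈ L', w b := sum_le_sum_of_subset' w hw hK'L'
  have e1 : 0 ≤ (1 - ∑ b ∈ V, w b) * ((∑ b ∈ K ∩ L', w b) - (∑ b ∈ K, w b) * (∑ b ∈ L', w b)) :=
    mul_nonneg (by linarith) (by linarith)
  have e2 : 0 ≤ (1 - ∑ b ∈ V, w b) * (((∑ b ∈ K, w b) - ∑ b ∈ L, w b) * ((∑ b ∈ L', w b) - ∑ b ∈ K', w b)) :=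
    mul_nonneg (by linarith) (mul_nonneg (by linarith) (by linarith))
  rw [hz, hzV] at hSig
  nlinarith [hSig, hDel, hRid, hwid, hHarKK', hHarL'L, e1, e2, hcut]

/-- **Low crossing on the `L'` side (pure class).**  Mirror of `exchange_pure_of_lowCrossK`: `Z = Ξ ⊆ V ∩ L'` with
`w(Z) = a(K∩L') − a(Σ)` and the pair `(K, L'∖Z)` on `Σ` (the case `L' ∩ ↓Ξ = Ξ`). [this work] -/
theorem exchange_pure_of_lowCrossL' [Fintype B] (w R : B → ℝ) (hw : ∀ b, 0 ≤ w b) (hw1 : ∑ b, w b = 1)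
    (V K L K' L' Z : Finset B) (hLK : L ⊆ K) (hK'L' : K' ⊆ L') (hZL' : Z ⊆ L') (hZV : Z ⊆ V)
    (hZ : ∑ b ∈ Z, w b = (∑ b ∈ (K ∩ L') ∩ V, w b) - ∑ b ∈ (K ∩ K' ∪ L ∩ L') ∩ V, w b)
    (hSig : (∑ b ∈ K, w b) * (∑ b ∈ (L' \ Z) ∩ V, w b) + (∑ b ∈ L' \ Z, w b) * (∑ b ∈ K ∩ V, w b)
        - (∑ b ∈ V, w b) * (∑ b ∈ K, w b) * (∑ b ∈ L' \ Z, w b) ≤ ∑ b ∈ (K ∩ K' ∪ L ∩ L') ∩ V, R b)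
    (hDel : (∑ b ∈ L, w b) * (∑ b ∈ K' ∩ V, w b) + (∑ b ∈ K', w b) * (∑ b ∈ L ∩ V, w b)
        - (∑ b ∈ V, w b) * (∑ b ∈ L, w b) * (∑ b ∈ K', w b) ≤ ∑ b ∈ (L ∩ K') ∩ V, R b)
    (hHarKK' : (∑ b ∈ K, w b) * (∑ b ∈ K' ∩ V, w b) ≤ ∑ b ∈ (K ∩ K') ∩ V, w b)
    (hHarL'L : (∑ b ∈ L', w b) * (∑ b ∈ L ∩ V, w b) ≤ ∑ b ∈ (L ∩ L') ∩ V, w b)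
    (hHar₄ : (∑ b ∈ K, w b) * (∑ b ∈ L', w b) ≤ ∑ b ∈ K ∩ L', w b) :
    0 ≤ (∑ b ∈ (K ∩ L') ∩ V, w b) + (∑ b ∈ (L ∩ K') ∩ V, w b)
        - (∑ b ∈ K, w b) * (∑ b ∈ K' ∩ V, w b) - (∑ b ∈ L', w b) * (∑ b ∈ L ∩ V, w b)
        + (∑ b ∈ (K ∩ K') ∩ V, R b) + (∑ b ∈ (L ∩ L') ∩ V, R b)
        - ((∑ b ∈ K, w b) * (∑ b ∈ L' ∩ V, w b) + (∑ b ∈ L', w b) * (∑ b ∈ K ∩ V, w b)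
            - (∑ b ∈ V, w b) * (∑ b ∈ K, w b) * (∑ b ∈ L', w b))
        - ((∑ b ∈ L, w b) * (∑ b ∈ K' ∩ V, w b) + (∑ b ∈ K', w b) * (∑ b ∈ L ∩ V, w b)
            - (∑ b ∈ V, w b) * (∑ b ∈ L, w b) * (∑ b ∈ K', w b))
        + (1 - ∑ b ∈ V, w b) * (((∑ b ∈ K ∩ L', w b) - (∑ b ∈ K, w b) * (∑ b ∈ L', w b))
            + ((∑ b ∈ K, w b) - ∑ b ∈ L, w b) * ((∑ b ∈ L', w b) - ∑ b ∈ K', w b)) := by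
  have hZV' : Z ∩ V = Z := Finset.inter_eq_left.2 hZV
  have hv1 : ∑ b ∈ V, w b ≤ 1 := by
    rw [← hw1]; exact sum_le_sum_of_subset' w hw (Finset.subset_univ V)
  have haK : ∑ b ∈ K ∩ V, w b ≤ ∑ b ∈ V, w b := sum_le_sum_of_subset' w hw Finset.inter_subset_right
  have hk1 : ∑ b ∈ K, w b ≤ 1 := by
    rw [← hw1]; exact sum_le_sum_of_subset' w hw (Finset.subset_univ K)
  have hz0 : 0 ≤ ∑ b ∈ Z, w b := Finset.sum_nonneg fun b _ => hw b
  have hk0 : 0 ≤ ∑ b ∈ K, w b := Finset.sum_nonneg fun b _ => hw b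
  refine exchange_pure_of_cutL' w R hw hw1 V K L K' L' Z hLK hK'L' hZL' hSig hDel hHarKK' hHarL'L hHar₄ ?_
  rw [hZV', ← hZ]
  have e1 : 0 ≤ (∑ b ∈ Z, w b) * ((∑ b ∈ V, w b) - ∑ b ∈ K ∩ V, w b) := mul_nonneg hz0 (by linarith)
  have e2 : 0 ≤ (∑ b ∈ Z, w b) * ((1 - ∑ b ∈ V, w b) * (1 - ∑ b ∈ K, w b)) :=
    mul_nonneg hz0 (mul_nonneg (by linarith) (by linarith))
  nlinarith [e1, e2]

end Summit.CriticalPhenomena.PercolationContinuityZ3.Theorems.SahiE3ExchangePureCut
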